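import Literature.AlgebraicGeometry.Resolution.AlterationsPreSemiStableToSemiStable
import Literature.AlgebraicGeometry.Resolution.SemiStableFibresIntegral
import Literature.AlgebraicGeometry.Resolution.SemiStableCurvesBaseChange
import Literature.AlgebraicGeometry.Resolution.AdicCompletionRegular
import Mathlib.AlgebraicGeometry.AlgClosed.Basic
import Mathlib.RingTheory.HopkinsLevitzki
import Mathlib.RingTheory.Artinian.Ring
import HarnessLib

/-!
# The base of a semi-stable curve has dimension one less (de Jong 1996, 4.22: `dim Y = d`)

Topic: `Literature/AlgebraicGeometry/Resolution`. Bottom-up ingredient of the named fact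
`DeJong1996PreSemiStablePairToSemiStablePair` (`AlterationsPreSemiStable.lean`, de Jong 1996,
4.22 from "At this point we apply the induction hypothesis" on): the induction hypothesis of
Thm. 4.1 (`DeJong1996.StatementUpToDim k d`, pairs of dimension `≤ d`) is applied to the base
`(Y, D)` of the pointed semi-stable curve `f : X → Y`, `dim X = d + 1`, which needs
`dim Y ≤ d`. The vendored `DeJong1996.PreSemiStablePair` does not record `dim Y`, so this file
PROVES

* `IsSemiStableCurve.topologicalKrullDim_add_one_le` — for a semi-stable curve `f : X → Y`
  (de Jong 1996, 2.21, `IsSemiStableCurve`) over a scheme `Y` locally of finite type over an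
  algebraically closed field and quasi-compact: `dim Y + 1 ≤ dim X`;
* `DeJong1996.PreSemiStablePair.topologicalKrullDim_base_le` — for a pre-semi-stable pair with
  `dim X = d + 1`: `dim Y ≤ d`; `DeJong1996.PreSemiStablePair.topologicalKrullDim_base_lt_of_isAlgClosed`
  — `dim Y < dim X`, the hypothesis `hdim` of
  `DeJong1996PreSemiStablePairToSemiStablePair.of_pullback_isIntegral_of_dim`
  (`AlterationsPreSemiStablePullback.lean`) and of `….of_liu_of_dim` (`SemiStableFibresIntegral.lean`),
  which is thereby DISCHARGED: `DeJong1996PreSemiStablePairToSemiStablePair.of_pullbackFamilyIntegral`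
  (4.22b from the single leaf `DeJong1996PullbackFamilyIntegral`, dropping
  `SemiStableCurveRelativeDimensionOne` from `….of_pullbackFamilyIntegral_of_relativeDimension`),
  `DeJong1996PreSemiStablePairToSemiStablePair.of_liu` (4.22b from Liu 2002, Prop. 4.3.8 alone) and
  `DeJong1996MultisectionToSemiStablePair.of_toPre_of_liu` (4.15–4.22 from 4.15–4.22a and
  Liu 4.3.8).

The proof is elementary given Mathlib's `coheight x = dim 𝒪_{X,x}` (Stacks 02IZ): `f` is flat,
hence generalizing (Mathlib `Flat.generalizingMap`), so every chain of specialisations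
`y₀ ⤳ ⋯ ⤳ yₘ` of `Y` lifts to `X` from any point over `y₀` upwards
(`exists_ltSeries_head_eq_of_cofibration`); every point of the quasi-compact `Y` specialises to
a closed point `c`, and the fibre over `c` — the geometric fibre, `κ(c) = k` being algebraically
closed (Mathlib `residueFieldIsoBase`) — has a closed point whose local ring has dimension `≥ 1`:
it is regular of dimension `1` or an ordinary double point, and **the local ring of an ordinary
double point has positive dimension** (`IsOrdinaryDoublePoint.one_le_ringKrullDim`: otherwise its
completion `K⟦u, v⟧/(uv)` — of the same dimension, `ringKrullDim_adicCompletion` — would be an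
Artinian local ring, with nilpotent maximal ideal, but no power of `u` lies in `(uv)`). So the
fibre over `c` contains a proper specialisation `x₁ ⤳ x₀`, which adds one link below every lifted
chain (`krullDim_add_one_le_of_cofibration`).

## Sources

* A. J. de Jong, *Smoothness, semi-stability and alterations*, Publ. Math. IHÉS 83 (1996) 51–93:
  2.21 (p. 61), 4.22 (p. 74: the induction hypothesis applied to `(Y, D)`, `dim Y = dim X - 1`).
* The Stacks Project, Tag 02IZ (`dim 𝒪_{X,x}` is the codimension of `x`).
-/

noncomputable section

open CategoryTheory CategoryTheory.Limits AlgebraicGeometry TopologicalSpace Topology Order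

namespace Literature.AlgebraicGeometry.Resolution

universe u

/-! ## Order theory: chains lift along a cofibration, plus one link at the bottom -/

section OrderTheory

variable {α β : Type*} [Preorder α] [Preorder β]

/-- **Chain lifting, upwards.** If `f : α → β` lifts strict inequalities above its values (for
every `f a < b` there is `a < a'` with `f a' = b`; the order-theoretic form of "generizations
lift", e.g. a flat morphism of schemes), then every strict chain of `β` starting at `f a` lifts
to a strict chain of `α` of the same length starting at `a`, ending over the end of the given
chain. [folklore] -/
theorem exists_ltSeries_head_eq_of_cofibration (f : α → β)
    (hf : ∀ ⦃a : α⦄ ⦃b : β⦄, f a < b → ∃ a', a < a' ∧ f a' = b)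
    (p : LTSeries β) {a : α} (ha : f a = p.head) :
    ∃ q : LTSeries α, q.length = p.length ∧ q.head = a ∧ f q.last = p.last := by
  induction p using RelSeries.inductionOn' with
  | singleton x =>
    refine ⟨RelSeries.singleton _ a, rfl, rfl, ?_⟩
    rw [RelSeries.last_singleton, RelSeries.last_singleton]
    rwa [RelSeries.head_singleton] at ha
  | snoc p x hx ih =>
    rw [RelSeries.head_snoc] at ha
    obtain ⟨q, hq, hqhead, hqlast⟩ := ih ha
    have hlt : f q.last < x := by
      rw [hqlast]
      exact hx
    obtain ⟨a', ha', hfa'⟩ := hf hlt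
    refine ⟨q.snoc a' ha', ?_, ?_, ?_⟩
    · simp [hq]
    · rw [RelSeries.head_snoc, hqhead]
    · rw [RelSeries.last_snoc, RelSeries.last_snoc, hfa']

/-- In `WithBot ℕ∞`: `d < 1` gives `d ≤ 0`. [folklore] -/
theorem WithBotENat.le_zero_of_lt_one {d : WithBot ℕ∞} (h : d < 1) : d ≤ 0 := by
  rw [← zero_add (1 : WithBot ℕ∞), ← Nat.cast_zero, ENat.WithBot.lt_add_one_iff] at h
  rwa [← Nat.cast_zero]

/-- In `WithBot ℕ∞`: `d + 1 ≤ n + 1` for a natural number `n` gives `d ≤ n`. [folklore] -/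
theorem WithBotENat.le_natCast_of_add_one_le {d : WithBot ℕ∞} {n : ℕ}
    (h : d + 1 ≤ ((n + 1 : ℕ) : WithBot ℕ∞)) : d ≤ n := by
  rw [Nat.cast_add, Nat.cast_one] at h
  exact ENat.WithBot.add_le_add_one_right_iff.mp h

/-- If every strict chain of `β` is shorter than some strict chain of `α`, then
`krullDim β + 1 ≤ krullDim α` (in `WithBot ℕ∞`). [folklore] -/
theorem krullDim_add_one_le_of_forall_ltSeries
    (h : ∀ p : LTSeries β, ∃ q : LTSeries α, p.length + 1 ≤ q.length) :
    krullDim β + 1 ≤ krullDim α := by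
  cases isEmpty_or_nonempty β with
  | inl _ =>
    rw [krullDim_eq_bot]
    simp
  | inr _ =>
    obtain ⟨q₀, -⟩ := h (RelSeries.singleton _ (Classical.arbitrary β))
    haveI : Nonempty α := ⟨q₀.head⟩
    cases finiteDimensionalOrder_or_infiniteDimensionalOrder α with
    | inr _ =>
      rw [krullDim_eq_top (α := α)]
      exact le_top
    | inl _ =>
      rw [krullDim_eq_length_of_finiteDimensionalOrder (α := α), ENat.WithBot.add_one_le_natCast_iff,
        krullDim_lt_coe_iff]
      intro p
      obtain ⟨q, hq⟩ := h p
      have := RelSeries.length_le_length_longestOf _ q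
      change q.length ≤ (LTSeries.longestOf α).length at this
      omega

/-- **One more link.** Let `f : α → β` lift strict inequalities above its values, and suppose
that below every `b ∈ β` (`f a₁ = b` or `f a₁ < b`) there is a value `f a₁` carrying a strict
inequality `a₀ < a₁` of `α`. Then `krullDim β + 1 ≤ krullDim α`: prolong a chain of `β` down to
such a value, lift it from `a₁`, and prepend `a₀`. [folklore] -/
theorem krullDim_add_one_le_of_cofibration (f : α → β)
    (hf : ∀ ⦃a : α⦄ ⦃b : β⦄, f a < b → ∃ a', a < a' ∧ f a' = b)
    (H : ∀ b : β, ∃ a₀ a₁ : α, a₀ < a₁ ∧ (f a₁ = b ∨ f a₁ < b)) :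
    krullDim β + 1 ≤ krullDim α := by
  refine krullDim_add_one_le_of_forall_ltSeries fun p => ?_
  obtain ⟨a₀, a₁, h01, h₁⟩ := H p.head
  -- a chain `p'` at least as long as `p`, starting at `f a₁`
  obtain ⟨p', hlen, hhead⟩ : ∃ p' : LTSeries β, p.length ≤ p'.length ∧ f a₁ = p'.head := by
    rcases h₁ with h₁ | h₁
    · exact ⟨p, le_rfl, h₁⟩
    · exact ⟨p.cons (f a₁) h₁, by simp, (RelSeries.head_cons _ _ _).symm⟩
  obtain ⟨q, hq, hqhead, -⟩ := exists_ltSeries_head_eq_of_cofibration f hf p' hhead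
  refine ⟨q.cons a₀ (show a₀ < q.head by rw [hqhead]; exact h01), ?_⟩
  simp only [RelSeries.cons_length]
  omega

end OrderTheory

/-- For a scheme, the topological Krull dimension is the Krull dimension of its points under
the specialisation preorder (Mathlib's default order on a scheme: `x ≤ y ↔ y ⤳ x`), via generic
points (Mathlib `irreducibleSetEquivPoints`). [folklore] -/
theorem topologicalKrullDim_eq_krullDim_carrier (X : Scheme.{u}) :
    topologicalKrullDim X = krullDim X :=
  Order.krullDim_eq_of_orderIso (irreducibleSetEquivPoints (α := X))

/-! ## The local ring of an ordinary double point has positive dimension -/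

namespace IsOrdinaryDoublePoint

variable (K : Type u) [Field K]

/-- No power of `u` lies in the ideal `(uv)` of `K⟦u, v⟧`: `v` does not divide `uⁿ`, the
coefficient of `uⁿ` at the monomial `uⁿ` being `1`. [folklore] -/
theorem X_pow_notMem_span (n : ℕ) :
    (MvPowerSeries.X 0 : MvPowerSeries (Fin 2) K) ^ n ∉
      Ideal.span {(MvPowerSeries.X 0 * MvPowerSeries.X 1 : MvPowerSeries (Fin 2) K)} := by
  classical
  intro h
  rw [Ideal.mem_span_singleton] at h
  have h1 : (MvPowerSeries.X 1 : MvPowerSeries (Fin 2) K) ∣ MvPowerSeries.X 0 ^ n :=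
    dvd_trans (dvd_mul_left _ _) h
  have h2 := (MvPowerSeries.X_dvd_iff.mp h1) (Finsupp.single 0 n)
    (by rw [Finsupp.single_apply, if_neg (by decide)])
  rw [MvPowerSeries.coeff_X_pow, if_pos rfl] at h2
  exact one_ne_zero h2

/-- The class of `u` in `K⟦u, v⟧/(uv)` is not a unit: `u · W - 1 ∈ (uv)` would make `u` divide
`1`. [folklore] -/
theorem not_isUnit_mk_X :
    ¬ IsUnit (Ideal.Quotient.mk
      (Ideal.span {(MvPowerSeries.X 0 * MvPowerSeries.X 1 : MvPowerSeries (Fin 2) K)})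
        (MvPowerSeries.X 0)) := by
  intro hu
  obtain ⟨w, hw⟩ := hu.exists_right_inv
  obtain ⟨W, rfl⟩ := Ideal.Quotient.mk_surjective w
  rw [← map_mul, ← map_one (Ideal.Quotient.mk _), Ideal.Quotient.eq,
    Ideal.mem_span_singleton] at hw
  have h1 : (MvPowerSeries.X 0 : MvPowerSeries (Fin 2) K) ∣ MvPowerSeries.X 0 * W - 1 :=
    dvd_trans (dvd_mul_right _ _) hw
  have h0 : (MvPowerSeries.X 0 : MvPowerSeries (Fin 2) K) ∣ 1 := by
    have := dvd_sub (dvd_mul_right (MvPowerSeries.X 0 : MvPowerSeries (Fin 2) K) W) h1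
    rwa [sub_sub_cancel] at this
  have h3 := (MvPowerSeries.X_dvd_iff.mp h0) 0 (by simp)
  simp at h3

/-- **The local ring of an ordinary double point has dimension `≥ 1`.** For a Noetherian local
ring `𝒪` with `𝒪̂ ≅ K⟦u, v⟧/(uv)`: `dim 𝒪̂ = dim 𝒪` (`ringKrullDim_adicCompletion`), and if this
were `0` the Noetherian local ring `K⟦u, v⟧/(uv)` would be Artinian, with nilpotent maximal
ideal, whereas no power of the non-unit `u` vanishes in it (`X_pow_notMem_span`). [folklore] -/
theorem one_le_ringKrullDim {C : Scheme.{u}} {x : C} [IsNoetherianRing (C.presheaf.stalk x)]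
    (h : IsOrdinaryDoublePoint K x) : 1 ≤ ringKrullDim (C.presheaf.stalk x) := by
  obtain ⟨e⟩ := h
  by_contra hlt
  have h0 : ringKrullDim (C.presheaf.stalk x) = 0 :=
    le_antisymm (WithBotENat.le_zero_of_lt_one (not_le.mp hlt)) ringKrullDim_nonneg_of_nontrivial
  -- the completion, hence the node ring, is a Noetherian local ring of dimension `0`
  haveI : IsNoetherianRing (AdicCompletion (IsLocalRing.maximalIdeal (C.presheaf.stalk x))
      (C.presheaf.stalk x)) :=
    isNoetherianRing_adicCompletion_maximalIdeal _
  haveI hN := isNoetherianRing_of_ringEquiv _ e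
  haveI : Nontrivial (MvPowerSeries (Fin 2) K ⧸
      Ideal.span {(MvPowerSeries.X 0 * MvPowerSeries.X 1 : MvPowerSeries (Fin 2) K)}) :=
    e.injective.nontrivial
  haveI := IsLocalRing.of_surjective' e.toRingHom e.surjective
  have hdim : ringKrullDim (MvPowerSeries (Fin 2) K ⧸
      Ideal.span {(MvPowerSeries.X 0 * MvPowerSeries.X 1 : MvPowerSeries (Fin 2) K)}) = 0 := by
    rw [← ringKrullDim_eq_of_ringEquiv e, ringKrullDim_adicCompletion, h0]
  haveI : Ring.KrullDimLE 0 (MvPowerSeries (Fin 2) K ⧸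
      Ideal.span {(MvPowerSeries.X 0 * MvPowerSeries.X 1 : MvPowerSeries (Fin 2) K)}) :=
    Ring.krullDimLE_iff.mpr hdim.le
  haveI : IsArtinianRing (MvPowerSeries (Fin 2) K ⧸
      Ideal.span {(MvPowerSeries.X 0 * MvPowerSeries.X 1 : MvPowerSeries (Fin 2) K)}) :=
    isArtinianRing_iff_isNoetherianRing_krullDimLE_zero.mpr ⟨hN, inferInstance⟩
  -- so its maximal ideal is nilpotent, contradicting `X_pow_notMem_span`
  obtain ⟨n, hn⟩ := IsArtinianRing.isNilpotent_jacobson_bot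
    (R := MvPowerSeries (Fin 2) K ⧸
      Ideal.span {(MvPowerSeries.X 0 * MvPowerSeries.X 1 : MvPowerSeries (Fin 2) K)})
  rw [IsLocalRing.jacobson_eq_maximalIdeal ⊥ bot_ne_top] at hn
  have hmem : Ideal.Quotient.mk
      (Ideal.span {(MvPowerSeries.X 0 * MvPowerSeries.X 1 : MvPowerSeries (Fin 2) K)})
        (MvPowerSeries.X 0) ∈ IsLocalRing.maximalIdeal _ :=
    (IsLocalRing.mem_maximalIdeal _).mpr (mem_nonunits_iff.mpr (not_isUnit_mk_X K))
  have hpow := Ideal.pow_mem_pow hmem n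
  rw [hn, Ideal.zero_eq_bot, Ideal.mem_bot, ← map_pow, Ideal.Quotient.eq_zero_iff_mem] at hpow
  exact X_pow_notMem_span K n hpow

end IsOrdinaryDoublePoint

/-! ## Fibres of a semi-stable curve contain proper specialisations -/

namespace IsSemiStableCurve

variable {k : Type u} [Field k] [IsAlgClosed k] {X Y : Scheme.{u}} {f : X ⟶ Y}

/-- **The fibre of a semi-stable curve over a closed point is positive-dimensional.** Let
`f : X → Y` be a semi-stable curve (de Jong 1996, 2.21) with `Y` locally of finite type over an
algebraically closed field `k`, and let `c ∈ Y` be a closed point. Then `f⁻¹(c)` contains two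
points `x₁ ≠ x₀` with `x₁ ⤳ x₀`. Indeed `κ(c) = k` (Mathlib `residueFieldIsoBase`), so the
scheme-theoretic fibre `X_c` is a geometric fibre: it is connected, hence non-empty, and at a
closed point its local ring is regular of dimension `1` or an ordinary double point, of
dimension `≥ 1` (`IsOrdinaryDoublePoint.one_le_ringKrullDim`); as `dim 𝒪 = codim`
(Stacks 02IZ), that closed point has a proper generisation in `X_c ↪ X`. [folklore] -/
theorem exists_specializes_ne (h : IsSemiStableCurve f) (g : Y ⟶ Spec (.of k))
    [LocallyOfFiniteType g] (c : Y) (hc : IsClosed ({c} : Set Y)) :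
    ∃ x₀ x₁ : X, f x₀ = c ∧ f x₁ = c ∧ x₁ ⤳ x₀ ∧ x₁ ≠ x₀ := by
  haveI := h.flat
  haveI := h.isProper
  haveI := h.locallyOfFinitePresentation
  -- the geometric point of `Y` at `c` and the geometric fibre `X ×_Y Spec k ≅ X_c`
  let ι := residueFieldIsoBase g c hc
  let s : Spec (.of k) ⟶ Y := pointOfClosedPoint g c hc
  have e₃ : pullback (pullback.snd f (Y.fromSpecResidueField c)) (Spec.map ι.hom) ≅
      pullback f (Y.fromSpecResidueField c) :=
    asIso (pullback.fst (pullback.snd f (Y.fromSpecResidueField c)) (Spec.map ι.hom))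
  have e : pullback f s ≅ f.fiber c :=
    pullback.congrHom rfl (show s = Spec.map ι.hom ≫ Y.fromSpecResidueField c from rfl) ≪≫
      (pullbackLeftPullbackSndIso f (Y.fromSpecResidueField c) (Spec.map ι.hom)).symm ≪≫ e₃
  -- `X_c` is connected (non-empty), compact, locally Noetherian: pick a closed point `g₀`
  haveI : ConnectedSpace ↥(pullback f s) := h.connectedSpace_pullback k s
  haveI : ConnectedSpace ↥(f.fiber c) :=
    (Scheme.homeoOfIso e).surjective.connectedSpace (Scheme.homeoOfIso e).continuous
  haveI : LocallyOfFiniteType (f.fiberToSpecResidueField c) :=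
    MorphismProperty.pullback_snd _ _ inferInstance
  haveI : IsLocallyNoetherian (f.fiber c) :=
    LocallyOfFiniteType.isLocallyNoetherian (f.fiberToSpecResidueField c)
  obtain ⟨g₀, -, hg₀⟩ := (isClosed_univ : IsClosed (Set.univ : Set ↥(f.fiber c)))
    |>.exists_closed_singleton Set.univ_nonempty
  -- its local ring has dimension `≥ 1`
  have hcond := IsSemiStableCurve.fibreCondition_of_iso k e
    (h.isRegularLocalRing_or_isOrdinaryDoublePoint k s) g₀ hg₀
  have hdim : 1 ≤ ringKrullDim ((f.fiber c).presheaf.stalk g₀) := by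
    rcases hcond with ⟨-, h1⟩ | hnode
    · rw [h1]
    · exact hnode.one_le_ringKrullDim k
  -- hence `g₀` has a proper generisation `g₁` in `X_c`
  have hmax : ¬ IsMax g₀ := by
    intro hM
    rw [ringKrullDim_stalk_eq_coheight, Order.coheight_eq_zero.mpr hM] at hdim
    have h01 : ¬ ((1 : WithBot ℕ∞) ≤ ((0 : ℕ∞) : WithBot ℕ∞)) := by
      rw [← WithBot.coe_one, WithBot.coe_le_coe]
      exact not_le.mpr zero_lt_one
    exact h01 hdim
  obtain ⟨g₁, hg₁⟩ := not_isMax_iff.mp hmax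
  have hmem : ∀ z : ↥(f.fiber c), f (f.fiberι c z) = c := fun z => by
    have hz : f.fiberι c z ∈ f ⁻¹' {c} := f.range_fiberι c ▸ Set.mem_range_self z
    simpa using hz
  refine ⟨f.fiberι c g₀, f.fiberι c g₁, hmem g₀, hmem g₁, ?_, ?_⟩
  · exact (show g₁ ⤳ g₀ from hg₁.le).map (f.fiberι c).continuous
  · intro heq
    exact hg₁.ne ((f.fiberι c).isEmbedding.injective heq).symm

/-- **The base of a semi-stable curve has dimension one less, `dim Y + 1 ≤ dim X`.** Let
`f : X → Y` be a semi-stable curve (de Jong 1996, 2.21) with `Y` quasi-compact and locally of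
finite type over an algebraically closed field. Every chain of specialisations of `Y` can be
prolonged down to a closed point `c` (`Y` is quasi-compact), over which the fibre contains a
proper specialisation `x₁ ⤳ x₀` (`exists_specializes_ne`); the chain then lifts to `X` upwards
from `x₁`, `f` being flat and so generalizing (Mathlib `Flat.generalizingMap`), and `x₀` is one
more link. This is the inequality `dim Y ≤ dim X - 1` used in de Jong 1996, 4.22, to apply the
induction hypothesis to the base `(Y, D)`. [folklore] -/
theorem topologicalKrullDim_add_one_le (h : IsSemiStableCurve f) (g : Y ⟶ Spec (.of k))
    [LocallyOfFiniteType g] [CompactSpace Y] :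
    topologicalKrullDim Y + 1 ≤ topologicalKrullDim X := by
  haveI := h.flat
  rw [topologicalKrullDim_eq_krullDim_carrier X, topologicalKrullDim_eq_krullDim_carrier Y]
  refine krullDim_add_one_le_of_cofibration (fun x : X => f x) ?_ ?_
  · -- generisations lift along the flat `f`
    intro a b hab
    obtain ⟨a', ha', hfa'⟩ := Flat.generalizingMap f (show b ⤳ f a from hab.le)
    refine ⟨a', lt_of_le_not_ge ha' fun hle => hab.not_ge ?_, hfa'⟩
    change f a ⤳ b
    rw [← hfa']
    exact (show a ⤳ a' from hle).map f.continuous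
  · intro y
    -- a closed point `c` with `y ⤳ c`, and a proper specialisation in the fibre over `c`
    obtain ⟨c, hc_mem, hc⟩ := (isClosed_closure : IsClosed (closure ({y} : Set Y)))
      |>.exists_closed_singleton ⟨y, subset_closure rfl⟩
    have hyc : y ⤳ c := specializes_iff_mem_closure.mpr hc_mem
    obtain ⟨x₀, x₁, -, hx₁, hsp, hne⟩ := h.exists_specializes_ne g c hc
    refine ⟨x₀, x₁, lt_of_le_not_ge hsp fun h' => hne (hsp.antisymm h').eq, ?_⟩
    rw [hx₁]
    by_cases hcy : c = y
    · exact Or.inl hcy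
    · refine Or.inr (lt_of_le_not_ge hyc fun h' => hcy ?_)
      have hy : y ∈ closure ({c} : Set Y) := specializes_iff_mem_closure.mp h'
      rw [hc.closure_eq] at hy
      exact (Set.mem_singleton_iff.mp hy).symm

end IsSemiStableCurve

/-! ## The base of a pre-semi-stable pair -/

namespace DeJong1996.PreSemiStablePair

variable {k : Type u} [Field k] [IsAlgClosed k] {X Y : Scheme.{u}} {f : X ⟶ Y}
  {g : Y ⟶ Spec (.of k)} {D : Set Y} {n : ℕ} {τ : Fin n → (Y ⟶ X)}

/-- For a pre-semi-stable pair over an algebraically closed field (de Jong 1996, 4.22),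
`dim Y + 1 ≤ dim X`. [cite: DeJong1996, 4.22, p. 74] -/
theorem topologicalKrullDim_base_add_one_le (h : PreSemiStablePair f g D τ) :
    topologicalKrullDim Y + 1 ≤ topologicalKrullDim X := by
  haveI : IsProper g :=
    Literature.AlgebraicGeometry.Motives.IsProjectiveOver.isProper (X := Over.mk g)
      h.isProjectiveOver_base
  haveI : CompactSpace Y := (quasiCompact_iff_compactSpace g).mp inferInstance
  exact h.isSemiStableCurve.topologicalKrullDim_add_one_le g

/-- **`dim Y = d` in de Jong 1996, 4.22**: for a pre-semi-stable pair over an algebraically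
closed field with `dim X = d + 1`, the base has `dim Y ≤ d`, so that the induction hypothesis
`DeJong1996.StatementUpToDim k d` applies to the pair `(Y, D)` ("At this point we apply the
induction hypothesis: there exists a nonsingular projective variety `Y'` and a generically étale
alteration `ψ : Y' → Y` such that the closed subset `ψ⁻¹(D)` is a strict normal crossings
divisor"). [cite: DeJong1996, 4.22, p. 74] -/
theorem topologicalKrullDim_base_le (h : PreSemiStablePair f g D τ) {d : ℕ}
    (hdim : topologicalKrullDim X = (d + 1 : ℕ)) : topologicalKrullDim Y ≤ d := by
  have := h.topologicalKrullDim_base_add_one_le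
  rw [hdim] at this
  exact WithBotENat.le_natCast_of_add_one_le this

/-- The induction hypothesis of Thm. 4.1 in dimension `≤ d` serves the base `(Y, D)` of a
pre-semi-stable pair of dimension `d + 1`: a generically étale alteration `ψ : Y₁ → Y` and an
open immersion `j : Y₁ → Ȳ₁` into a regular projective variety with
`j(ψ⁻¹(D)) ∪ (Ȳ₁ ∖ j(Y₁))` a strict normal crossings divisor (de Jong 1996, 4.22: "At this point
we apply the induction hypothesis"). [cite: DeJong1996, 4.22, p. 74] -/
theorem conclusionGenericallyEtale_base (h : PreSemiStablePair f g D τ) {d : ℕ}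
    (ih : StatementUpToDim k d) (hdim : topologicalKrullDim X = (d + 1 : ℕ)) :
    ConclusionGenericallyEtale g D := by
  haveI := h.isIntegral_base
  haveI : IsProper g :=
    Literature.AlgebraicGeometry.Motives.IsProjectiveOver.isProper (X := Over.mk g)
      h.isProjectiveOver_base
  exact ih Y g D inferInstance inferInstance inferInstance inferInstance
    (h.topologicalKrullDim_base_le hdim) h.isClosed h.ne_univ

/-- **`dim Y < dim X` for a pre-semi-stable pair over an algebraically closed field** — the
hypothesis `hdim` of `DeJong1996PreSemiStablePairToSemiStablePair.of_pullback_isIntegral_of_dim`,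
proved: `dim Y + 1 ≤ dim X` (`topologicalKrullDim_base_add_one_le`) and `dim Y` is finite (`Y`
is of finite type over `k`, `exists_topologicalKrullDim_le_of_locallyOfFiniteType`) and not `⊥`
(`Y` is non-empty). [cite: DeJong1996, 4.22, p. 74] -/
theorem topologicalKrullDim_base_lt_of_isAlgClosed (h : PreSemiStablePair f g D τ) :
    topologicalKrullDim Y < topologicalKrullDim X := by
  haveI := h.isIntegral_base
  haveI := h.isProper_base
  haveI : CompactSpace Y := QuasiCompact.compactSpace_of_compactSpace g
  have hle := h.topologicalKrullDim_base_add_one_le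
  obtain ⟨e, he⟩ := exists_topologicalKrullDim_le_of_locallyOfFiniteType g
  have hbot : topologicalKrullDim Y ≠ ⊥ := by
    rw [ne_eq, topologicalKrullDim, Order.krullDim_eq_bot_iff, not_isEmpty_iff]
    exact ⟨⟨_, (isIrreducible_singleton (x := genericPoint Y)).closure, isClosed_closure⟩⟩
  revert hle he hbot
  generalize topologicalKrullDim Y = a
  intro hle he hbot
  induction a using WithBot.recBotCoe with
  | bot => exact absurd rfl hbot
  | coe a =>
    induction a using ENat.recTopCoe with
    | top =>
      rw [← WithBot.coe_natCast, WithBot.coe_le_coe, top_le_iff] at he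
      exact absurd he (ENat.coe_ne_top e)
    | coe a =>
      have hlt : ((a : ℕ∞) : WithBot ℕ∞) < ((a : ℕ∞) : WithBot ℕ∞) + 1 := by
        rw [← WithBot.coe_one, ← WithBot.coe_add, WithBot.coe_lt_coe]
        exact_mod_cast Nat.lt_succ_self a
      exact lt_of_lt_of_le hlt hle

end DeJong1996.PreSemiStablePair

/-! ## 4.22b with its dimension count discharged -/

/-- **de Jong 1996, 4.22 from "At this point" (`DeJong1996PreSemiStablePairToSemiStablePair`) from
the single leaf `DeJong1996PullbackFamilyIntegral`** (the pulled-back family `𝒞 ×_Y Y'` is a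
variety): the other hypothesis of
`DeJong1996PreSemiStablePairToSemiStablePair.of_pullback_isIntegral_of_dim`, the dimension count
`dim Y < dim 𝒞`, is `PreSemiStablePair.topologicalKrullDim_base_lt_of_isAlgClosed`. This drops the
named fact `SemiStableCurveRelativeDimensionOne` from
`….of_pullbackFamilyIntegral_of_relativeDimension`. [cite: DeJong1996, 4.22, pp. 74–75] -/
theorem DeJong1996PreSemiStablePairToSemiStablePair.of_pullbackFamilyIntegral
    (hP : DeJong1996PullbackFamilyIntegral.{u}) :
    DeJong1996PreSemiStablePairToSemiStablePair.{u} :=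
  DeJong1996PreSemiStablePairToSemiStablePair.of_pullback_isIntegral_of_dim
    (fun ψ h hY' hψ hψe => hP ψ h hY' hψ hψe)
    (fun h => h.topologicalKrullDim_base_lt_of_isAlgClosed)

/-- **4.22b from Liu 2002, Prop. 4.3.8 alone**: the integrality of the pulled-back family is
`PreSemiStablePair.isIntegral_pullback_of_liu` (`SemiStableFibresIntegral.lean`), the dimension
count is `PreSemiStablePair.topologicalKrullDim_base_lt_of_isAlgClosed`.
[cite: DeJong1996, 4.22, pp. 74–75] -/
theorem DeJong1996PreSemiStablePairToSemiStablePair.of_liu (hL : Liu2002IntegralOfFlat.{u}) :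
    DeJong1996PreSemiStablePairToSemiStablePair.{u} :=
  DeJong1996PreSemiStablePairToSemiStablePair.of_liu_of_dim hL
    (fun h => h.topologicalKrullDim_base_lt_of_isAlgClosed)

/-- **de Jong 1996, 4.15–4.22 (`DeJong1996MultisectionToSemiStablePair`) from 4.15–4.22a
(`DeJong1996MultisectionToPreSemiStablePair`) and Liu 2002, Prop. 4.3.8 (`Liu2002IntegralOfFlat`).**
[cite: DeJong1996, 4.15–4.22, pp. 71–75] -/
theorem DeJong1996MultisectionToSemiStablePair.of_toPre_of_liu
    (h₁ : DeJong1996MultisectionToPreSemiStablePair.{u}) (hL : Liu2002IntegralOfFlat.{u}) :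
    DeJong1996MultisectionToSemiStablePair.{u} :=
  DeJong1996MultisectionToSemiStablePair.of_toPre_of_preToSemiStable h₁
    (DeJong1996PreSemiStablePairToSemiStablePair.of_liu hL)

/-- `DeJong1996MultisectionToSemiStablePair` from 4.15–4.22a and the leaf
`DeJong1996PullbackFamilyIntegral`. [cite: DeJong1996, 4.15–4.22, pp. 71–75] -/
theorem DeJong1996MultisectionToSemiStablePair.of_toPre_of_pullbackFamilyIntegral'
    (h₁ : DeJong1996MultisectionToPreSemiStablePair.{u}) (hP : DeJong1996PullbackFamilyIntegral.{u}) :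
    DeJong1996MultisectionToSemiStablePair.{u} :=
  DeJong1996MultisectionToSemiStablePair.of_toPre_of_preToSemiStable h₁
    (DeJong1996PreSemiStablePairToSemiStablePair.of_pullbackFamilyIntegral hP)

/-- **Thm. 4.1 with its generically-étale clause over algebraically closed fields from the live
nodes** 4.11–4.12 (`DeJong1996FibrationReduction`), 4.14 (`DeJong1996MultisectionReduction`),
4.15–4.22a (`DeJong1996MultisectionToPreSemiStablePair`), Liu 2002, Prop. 4.3.8
(`Liu2002IntegralOfFlat`, for 4.22b) and 4.23–4.28 (`DeJong1996SemiStablePairResolution`).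
[cite: DeJong1996, 4.3–4.28, pp. 66–76] -/
theorem DeJong1996StrongAlgClosed.of_fiveBlocks_of_liu (h₀ : DeJong1996FibrationReduction.{u})
    (h14 : DeJong1996MultisectionReduction.{u}) (h₁ : DeJong1996MultisectionToPreSemiStablePair.{u})
    (hL : Liu2002IntegralOfFlat.{u}) (hres : DeJong1996SemiStablePairResolution.{u}) :
    DeJong1996StrongAlgClosed.{u} :=
  DeJong1996StrongAlgClosed.of_fourBlocks h₀ h14
    (DeJong1996MultisectionToSemiStablePair.of_toPre_of_liu h₁ hL) hres

/-- Thm. 4.1 (i)+(ii) and its last sentence from the limit argument of 4.5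
(`DeJong1996.FiniteSubextension45`), the live nodes 4.11–4.12, 4.14, 4.15–4.22a, 4.23–4.28 and
Liu 2002, Prop. 4.3.8. [cite: DeJong1996, Thm. 4.1, p. 66] -/
theorem DeJong1996Strong.of_finiteSubextension45_of_fiveBlocks_of_liu
    (H : DeJong1996.FiniteSubextension45.{u}) (h₀ : DeJong1996FibrationReduction.{u})
    (h14 : DeJong1996MultisectionReduction.{u}) (h₁ : DeJong1996MultisectionToPreSemiStablePair.{u})
    (hL : Liu2002IntegralOfFlat.{u}) (hres : DeJong1996SemiStablePairResolution.{u}) :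
    DeJong1996Strong.{u} ∧ DeJong1996StrongPerfect.{u} :=
  DeJong1996Strong.of_finiteSubextension45_of_fourBlocks H h₀ h14
    (DeJong1996MultisectionToSemiStablePair.of_toPre_of_liu h₁ hL) hres

end Literature.AlgebraicGeometry.Resolution

end
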